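import Mathlib
import HarnessLib
import Summits.HubbardSuperconductivity.HubbardSuperconductivity.Theorems.KLProgrammeKLRegimeEnginePairTransferOutClassSameFrame
import Summits.HubbardSuperconductivity.HubbardSuperconductivity.Theorems.KLProgrammeKLRegimeEnginePairTransferOutClassBornSigned

/-!
# Route `KLProgramme` — ENGINE item stmt-HubbardSuperconductivity-20437 `KLRegimeEngineV17F2`, stub (c) value lane, «(c)-OUT» CAPSTONE WITH THE BORN LINE SIGNED:
# the same-frame out-of-class increment with EXACTLY ONE `thermalBar` and the born residue named (cell gate-hubbard-kl, seat hubbard-kl-k3c2-p2 g18;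
# recipe HOME/hubbard-kl-k3c2-p2/OUT-OF-CLASS-E2.md §6)

`outClass_sameFrame_le_slots` (…OutClassSameFrame) keeps the born row as a binder `RS`; `born_member_row_signed_le_quarter` (…OutClassBornSigned) reads the
SIGNED born row in slots.  Composing the two (`RS := B_S/(a·c)`) gives **`outClass_sameFrame_le_slots_signedBorn`**: for every `n ≤ n_β`, every out-of-class
`Qm`, every `(x, y)`, every member index `j ≥ n+1`,
`‖A_j(1) − A_j(0)‖(x,y) ≤ (Λₙ−Λₙ₊₁)·½RH + RL + gainBar klEngGeo11 P U (n+1) ρpp ρd ρx + thermalBar klEngGeo11 P U β (n+1) + 4·LAT₀/L + 2ε·C + (ZS₀ˢ·Λₙ₊₁ + 2·LAT₀ˢ/L + 2εˢ·C)`,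
`C = 2048·15367` — thermal budget ¼ (direct) + ¼ (crossed / band) + ½ (born ×2) = the step's ONE `thermalBar`.  What is left BY NAME: `RH` (Hd, ≥ 2 cross lines) and
`RL` (LOC) — k3c1-p1's rows; the born main term `ZS₀ˢ·Λₙ₊₁` (→ `eremBar`'s cubic slot, `born_main_le_CR_slot`); the lattice terms (→ `Q.CL β n/L`,
`latticeTerm_div_le_CL_share`); the flatness terms `ε, εˢ` and the sizes of the dressed-moment data `(A₀, L_A)`, `(A₀ˢ, L_Aˢ)` («(E4)-DRESSED-MOMENTS»:
`ZS₀ ≤ 2⁵²K`, `TH₀ ≤ 2⁷⁶K`, `TH₀+2TR₀ ≤ 2⁷⁶K`, `TR₀G ≤ 2⁵²K`, `TH₀ˢ ≤ 2⁷⁷K`, `K = (Klam U)²`); outside the file the un-smearing (iii) and the frame shift (F)(i).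
Composition only; nothing about the model's sizes is asserted; nothing asserts (E2″-F), (c), K3 or superconductivity.  0 kit · 0 lit.
-/

noncomputable section

namespace Summit.HubbardSuperconductivity.HubbardSuperconductivity.Theorems.KLRegimeSplit

set_option linter.dupNamespace false -- summit = problem name (single-conjunct summit), D-0017

open Real Set Finset Complex Matrix Literature.MathematicalPhysics.QuantumLattice GrassmannAlgebra
open Literature.Probability.LatticeModels hiding torusSupNorm
open Literature.MathematicalPhysics.QuantumLattice.BandSectorCounting
open Summit.HubbardSuperconductivity.HubbardSuperconductivity.Theorems.KLProgrammeLegKernels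
open Summit.HubbardSuperconductivity.HubbardSuperconductivity.Theorems.KLRegimeWick
open Summit.HubbardSuperconductivity.HubbardSuperconductivity.Theorems.TwoPointAssembly
open Summit.HubbardSuperconductivity.HubbardSuperconductivity.Theorems.EngineV8
open Summit.HubbardSuperconductivity.HubbardSuperconductivity.Theorems.DispersionFlow
open Summit.HubbardSuperconductivity.HubbardSuperconductivity.Theorems.PerturbedFermiCurve

section Model

variable (L M : ℕ) [NeZero L] [NeZero M] (β U μ : ℝ) (K : TrigPolyC4v) {a' b' : ℝ} (B : BandBounds a' b') {R : RenConsts} {N : ℕ} {Af : ℝ}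

set_option maxHeartbeats 1600000 in -- ~70 literal binders passed through two doors; plumbing only
/-- **THE SAME-FRAME OUT-OF-CLASS INCREMENT WITH THE BORN LINE SIGNED** (module docstring). -/
theorem outClass_sameFrame_le_slots_signedBorn (hR : R.WF2) (hU : 0 < U) (hUu : U ≤ klTSU R) (hμC : μ ∈ klWindowC) (hK : FrameOK R U N μ K)
    (hβ : klBetaMin ≤ β) (hβL : β ≤ L) {n : ℕ} (hn : n ≤ nScales β) (hGL : 8 * (4 + 8 / 3 * R.Gfr 1 * U ^ 2) * β ≤ L) (hGU : 8 / 3 * R.Gfr 1 * U ^ 2 ≤ 1)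
    (hAb : ∀ p : Momentum, ∀ j ≤ 2, ‖iteratedFDeriv ℝ j (frameShift K) p‖ ≤ Af) (hA : 4 * Af < B.Dtmin) (hA20 : 4 * Af ≤ 1 / 20) (hμ : μ ≤ -0.15)
    (hlo : a' < μ - 4 * klScale klE0 (n + 1) - 4 * Af) (hhi : μ + 4 * klScale klE0 (n + 1) + 4 * Af < b')
    (hM : β * (4 * klScale klE0 (n + 1)) / (2 * Real.pi) + 1 ≤ M)
    (A A' : ℕ → TorusSite 2 L → ℝ → Matrix (TorusSite 2 L) (TorusSite 2 L) ℂ) (b' : ℕ → TorusSite 2 L → ℝ → TorusSite 2 L → ℂ)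
    (hAdef : A = fun j Qm t => Matrix.of fun k k' : TorusSite 2 L => if k ∈ klBall L μ 0 ∧ k' ∈ klBall L μ 0 then
      vertexFn L M β (gaussConv ℂ (softCovOf L M β μ K (softSymbolCompl L M β μ K (n + 1) j) + hubbardCovAboveCT L M β μ 0 K (klScale klE0 (n + 1)) - hubbardCovAboveCT L M β μ 0 K
              (klScale klE0 n + t * (klScale klE0 (n + 1) - klScale klE0 n))) (hubbardEffectiveActionCT L M β U μ 0 K (klScale klE0 n + t * (klScale klE0 (n + 1) - klScale klE0 n)))) 4
              ![(((omega0 M, k'), 0), 0), ((((omega0 M).rev, Qm - k'), 1), 0), ((((omega0 M).rev, Qm - k), 1), 1), (((omega0 M, k), 0), 1)]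
      else 0)
    (hA'def : A' = fun j Qm t => Matrix.of fun k k' : TorusSite 2 L => if k ∈ klBall L μ 0 ∧ k' ∈ klBall L μ 0 then
      (klScale klE0 (n + 1) - klScale klE0 n) • -((2 : ℂ)⁻¹ * vertexFn L M β (gaussConv ℂ (softCovOf L M β μ K (softSymbolCompl L M β μ K (n + 1) j) + hubbardCovAboveCT L M β μ 0 K
              (klScale klE0 (n + 1)) - hubbardCovAboveCT L M β μ 0 K (klScale klE0 n + t * (klScale klE0 (n + 1) - klScale klE0 n))) (grassmannDerivPairing ℂ (Matrix.of fun X Y :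
              HubbardFieldIdx L M => deriv (fun Λ'' : ℝ => hubbardCovAboveCT L M β μ 0 K Λ'' X Y) (klScale klE0 n + t * (klScale klE0 (n + 1) - klScale klE0 n)))
              (hubbardEffectiveActionCT L M β U μ 0 K (klScale klE0 n + t * (klScale klE0 (n + 1) - klScale klE0 n))) (hubbardEffectiveActionCT L M β U μ 0 K (klScale klE0 n + t *
              (klScale klE0 (n + 1) - klScale klE0 n))))) 4 ![(((omega0 M, k'), 0), 0), ((((omega0 M).rev, Qm - k'), 1), 0), ((((omega0 M).rev, Qm - k), 1), 1), (((omega0 M, k), 0),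
              1)])
      else 0)
    (hb'def : b' = fun (j : ℕ) (Qm : TorusSite 2 L) (t : ℝ) (p : TorusSite 2 L) => (((klScale klE0 (n + 1) - klScale klE0 n) *
        (klBubbleMass L M β μ K (fun k => deriv (fun Λ' => hubbardCutoffWeightCT L M β μ K Λ' k) (klScale klE0 n + t * (klScale klE0 (n + 1) - klScale klE0 n))) (fun k =>
                (softSymbolCompl L M β μ K (n + 1) j) k + (hubbardCutoffWeightCT L M β μ K (klScale klE0 (n + 1)) k - hubbardCutoffWeightCT L M β μ K (klScale klE0 n + t * (klScale
                klE0 (n + 1) - klScale klE0 n)) k)) Qm p +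
          klBubbleMass L M β μ K (fun k => (softSymbolCompl L M β μ K (n + 1) j) k + (hubbardCutoffWeightCT L M β μ K (klScale klE0 (n + 1)) k - hubbardCutoffWeightCT L M β μ K
                  (klScale klE0 n + t * (klScale klE0 (n + 1) - klScale klE0 n)) k)) (fun k => deriv (fun Λ' => hubbardCutoffWeightCT L M β μ K Λ' k) (klScale klE0 n + t * (klScale
                  klE0 (n + 1) - klScale klE0 n))) Qm p) : ℝ) : ℂ))
    (V : ℕ → ℝ → (Fin 4 → HubbardFieldIdx L M) → ℂ) (hV : V = fun j t X => vertexFn L M β (gaussConv ℂ (softCovOf L M β μ K (softSymbolCompl L M β μ K (n + 1) j) + hubbardCovAboveCT L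
            M β μ 0 K (klScale klE0 (n + 1)) - hubbardCovAboveCT L M β μ 0 K (klScale klE0 n + t * (klScale klE0 (n + 1) - klScale klE0 n))) (hubbardEffectiveActionCT L M β U μ 0 K
            (klScale klE0 n + t * (klScale klE0 (n + 1) - klScale klE0 n)))) 4 X)
    (V6 : ℕ → ℝ → (Fin 6 → HubbardFieldIdx L M) → ℂ) (hV6 : V6 = fun j t X => vertexFn L M β (gaussConv ℂ (softCovOf L M β μ K (softSymbolCompl L M β μ K (n + 1) j) + hubbardCovAboveCT
            L M β μ 0 K (klScale klE0 (n + 1)) - hubbardCovAboveCT L M β μ 0 K (klScale klE0 n + t * (klScale klE0 (n + 1) - klScale klE0 n))) (hubbardEffectiveActionCT L M β U μ 0 K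
            (klScale klE0 n + t * (klScale klE0 (n + 1) - klScale klE0 n)))) 6 X)
    (Sg : ℕ → ℝ → FreqMomentum L M → Fin 2 → ℂ) (hSg : Sg = fun j t p σ => selfEnergy L M β (gaussConv ℂ (softCovOf L M β μ K (softSymbolCompl L M β μ K (n + 1) j) + hubbardCovAboveCT
            L M β μ 0 K (klScale klE0 (n + 1)) - hubbardCovAboveCT L M β μ 0 K (klScale klE0 n + t * (klScale klE0 (n + 1) - klScale klE0 n))) (hubbardEffectiveActionCT L M β U μ 0 K
            (klScale klE0 n + t * (klScale klE0 (n + 1) - klScale klE0 n)))) p σ)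
    (Hd : ℕ → ℝ → (Fin 4 → HubbardFieldIdx L M) → ℂ) (hHd : Hd = fun j t X => vertexFn L M β (dblFold ℂ (grassmannLaplacian ℂ (crossCov ℂ (Matrix.of fun X Y : HubbardFieldIdx L M =>
            deriv (fun Λ' : ℝ => hubbardCovAboveCT L M β μ 0 K Λ' X Y) (klScale klE0 n + t * (klScale klE0 (n + 1) - klScale klE0 n)))) ((gaussConv ℂ (crossCov ℂ (softCovOf L M β μ K
            (softSymbolCompl L M β μ K (n + 1) j) + hubbardCovAboveCT L M β μ 0 K (klScale klE0 (n + 1)) - hubbardCovAboveCT L M β μ 0 K (klScale klE0 n + t * (klScale klE0 (n + 1) -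
            klScale klE0 n)))) - grassmannLaplacian ℂ (crossCov ℂ (softCovOf L M β μ K (softSymbolCompl L M β μ K (n + 1) j) + hubbardCovAboveCT L M β μ 0 K (klScale klE0 (n + 1)) -
            hubbardCovAboveCT L M β μ 0 K (klScale klE0 n + t * (klScale klE0 (n + 1) - klScale klE0 n))))) (dblCopy ℂ 0 (gaussConv ℂ (softCovOf L M β μ K (softSymbolCompl L M β μ K (n
            + 1) j) + hubbardCovAboveCT L M β μ 0 K (klScale klE0 (n + 1)) - hubbardCovAboveCT L M β μ 0 K (klScale klE0 n + t * (klScale klE0 (n + 1) - klScale klE0 n)))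
            (hubbardEffectiveActionCT L M β U μ 0 K (klScale klE0 n + t * (klScale klE0 (n + 1) - klScale klE0 n)))) * dblCopy ℂ 1 (gaussConv ℂ (softCovOf L M β μ K (softSymbolCompl L
            M β μ K (n + 1) j) + hubbardCovAboveCT L M β μ 0 K (klScale klE0 (n + 1)) - hubbardCovAboveCT L M β μ 0 K (klScale klE0 n + t * (klScale klE0 (n + 1) - klScale klE0 n)))
            (hubbardEffectiveActionCT L M β U μ 0 K (klScale klE0 n + t * (klScale klE0 (n + 1) - klScale klE0 n)))))))) 4 X)
    (Φ : ℕ → ℝ → FreqMomentum L M → ℝ) (hΦ : Φ = fun j t k => (softSymbolCompl L M β μ K (n + 1) j) k + (hubbardCutoffWeightCT L M β μ K (klScale klE0 (n + 1)) k -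
            hubbardCutoffWeightCT L M β μ K (klScale klE0 n + t * (klScale klE0 (n + 1) - klScale klE0 n)) k))
    (Wd : ℝ → FreqMomentum L M → ℝ) (hWd : Wd = fun t k => deriv (fun Λ' : ℝ => hubbardCutoffWeightCT L M β μ K Λ' k) (klScale klE0 n + t * (klScale klE0 (n + 1) - klScale klE0 n)))
    (Br : ℕ → TorusSite 2 L → ℝ → TorusSite 2 L × MatsubaraIdx M → ℂ) (hBr : Br = fun j Qm t z => -(((((β * (L : ℝ) ^ 2 : ℝ) : ℂ)))⁻¹ * propCT L M β μ K (z.2, z.1) * propCT L M β μ K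
            (z.2.rev, Qm - z.1)) *
      ((((klScale klE0 (n + 1) - klScale klE0 n) * (-Wd t (z.2, z.1) * Φ j t (z.2.rev, Qm - z.1) - Φ j t (z.2, z.1) * Wd t (z.2.rev, Qm - z.1))) : ℝ) : ℂ))
    (j : ℕ) (hj : n + 1 ≤ j) {Qm : TorusSite 2 L} (hQ : ¬ IsPairClassAt L Qm (n + 1))
    (hZ : ∀ Λ ∈ Icc (klScale klE0 (n + 1)) (klScale klE0 n), hubbardEffPartitionFnCT L M β U μ 0 K Λ ≠ 0)
    {P : SplitConsts} {m : ℝ} (hm0 : 0 ≤ m) (hm : m ^ 2 ≤ 2 ^ 8 * (P.Klam * U) ^ 2) (hAm : ∀ t ∈ Icc (0 : ℝ) 1, ∀ x y, ‖A j Qm t x y‖ ≤ m)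
    (x y : TorusSite 2 L) {M4 RH RL : ℝ} (hM40 : 0 ≤ M4) (hM4 : ∀ t ∈ Icc (0 : ℝ) 1, ∀ X, ‖V j t X‖ ≤ M4)
    (hM4K : M4 * M4 ≤ 2 ^ 3 * (P.Klam * U) ^ 2) (hM4KG : M4 * M4 * (4 + 8 / 3 * R.Gfr 1 * U ^ 2) ^ 2 ≤ 2 ^ 32 * (P.Klam * U) ^ 2)
    (hH : ∀ t ∈ Icc (0 : ℝ) 1, ‖Hd j t ![(((omega0 M, y), 0), 0), ((((omega0 M).rev, Qm - y), 1), 0), ((((omega0 M).rev, Qm - x), 1), 1), (((omega0 M, x), 0), 1)]‖ ≤ RH)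
    (hL : ∀ t ∈ Icc (0 : ℝ) 1, ‖∑ z : TorusSite 2 L × MatsubaraIdx M, Br j Qm t z *
          ((if z.1 ∈ klBall L μ 0 then
              V j t ![(((omega0 M, z.1), 0), 0), ((((omega0 M).rev, Qm - z.1), 1), 0), ((((omega0 M).rev, Qm - x), 1), 1), (((omega0 M, x), 0), 1)] *
                V j t ![(((omega0 M, y), 0), 0), ((((omega0 M).rev, Qm - y), 1), 0), ((((omega0 M).rev, Qm - z.1), 1), 1), (((omega0 M, z.1), 0), 1)]
            else 0) -
            V j t ![(((z.2, z.1), 0), 0), (((z.2.rev, Qm - z.1), 1), 0), ((((omega0 M).rev, Qm - x), 1), 1), (((omega0 M, x), 0), 1)] *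
              V j t ![(((omega0 M, y), 0), 0), ((((omega0 M).rev, Qm - y), 1), 0), (((z.2.rev, Qm - z.1), 1), 1), (((z.2, z.1), 0), 1)])‖ ≤ RL)
    {A₀ LA ε : ℝ} (hA0 : 0 ≤ A₀) (hLA : 0 ≤ LA) (hε : 0 ≤ ε)
    (hY0p : ∀ t ∈ Icc (0 : ℝ) 1, ∀ k : TorusSite 2 L, ‖∑ σ : Fin 2, V j t ![(((omega0 M, k), σ), 1), (((omega0 M, k + (x - y)), σ), 0), (((omega0 M, y), 0), 0), (((omega0 M, x), 0), 1)] *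
        V j t ![(((omega0 M, k), σ), 0), (((omega0 M, k + (x - y)), σ), 1), ((((omega0 M).rev, Qm - y), 1), 0), ((((omega0 M).rev, Qm - x), 1), 1)]‖ ≤ A₀)
    (hY1p : ∀ t ∈ Icc (0 : ℝ) 1, ∀ k k' : TorusSite 2 L, ‖(∑ σ : Fin 2, V j t ![(((omega0 M, k), σ), 1), (((omega0 M, k + (x - y)), σ), 0), (((omega0 M, y), 0), 0), (((omega0 M, x), 0), 1)] *
          V j t ![(((omega0 M, k), σ), 0), (((omega0 M, k + (x - y)), σ), 1), ((((omega0 M).rev, Qm - y), 1), 0), ((((omega0 M).rev, Qm - x), 1), 1)]) -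
        ∑ σ : Fin 2, V j t ![(((omega0 M, k'), σ), 1), (((omega0 M, k' + (x - y)), σ), 0), (((omega0 M, y), 0), 0), (((omega0 M, x), 0), 1)] *
          V j t ![(((omega0 M, k'), σ), 0), (((omega0 M, k' + (x - y)), σ), 1), ((((omega0 M).rev, Qm - y), 1), 0), ((((omega0 M).rev, Qm - x), 1), 1)]‖ ≤
        LA * klTorusNorm L (k - k'))
    (hY0m : ∀ t ∈ Icc (0 : ℝ) 1, ∀ k : TorusSite 2 L, ‖∑ σ : Fin 2, V j t ![(((omega0 M, k + -(x - y)), σ), 1), (((omega0 M, k), σ), 0), (((omega0 M, y), 0), 0), (((omega0 M, x), 0), 1)] *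
        V j t ![(((omega0 M, k + -(x - y)), σ), 0), (((omega0 M, k), σ), 1), ((((omega0 M).rev, Qm - y), 1), 0), ((((omega0 M).rev, Qm - x), 1), 1)]‖ ≤ A₀)
    (hY1m : ∀ t ∈ Icc (0 : ℝ) 1, ∀ k k' : TorusSite 2 L, ‖(∑ σ : Fin 2, V j t ![(((omega0 M, k + -(x - y)), σ), 1), (((omega0 M, k), σ), 0), (((omega0 M, y), 0), 0), (((omega0 M, x), 0), 1)] *
          V j t ![(((omega0 M, k + -(x - y)), σ), 0), (((omega0 M, k), σ), 1), ((((omega0 M).rev, Qm - y), 1), 0), ((((omega0 M).rev, Qm - x), 1), 1)]) -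
        ∑ σ : Fin 2, V j t ![(((omega0 M, k' + -(x - y)), σ), 1), (((omega0 M, k'), σ), 0), (((omega0 M, y), 0), 0), (((omega0 M, x), 0), 1)] *
          V j t ![(((omega0 M, k' + -(x - y)), σ), 0), (((omega0 M, k'), σ), 1), ((((omega0 M).rev, Qm - y), 1), 0), ((((omega0 M).rev, Qm - x), 1), 1)]‖ ≤
        LA * klTorusNorm L (k - k'))
    (hflat : ∀ t ∈ Icc (0 : ℝ) 1, ∀ (i : MatsubaraIdx M) (σ : Fin 2) (k k' : TorusSite 2 L), matsubaraFreq β M i ^ 2 ≤ (4 * klScale klE0 (n + 1)) ^ 2 →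
      ‖V j t ![(((i, k), σ), 1), (((i, k'), σ), 0), (((omega0 M, y), 0), 0), (((omega0 M, x), 0), 1)] *
            V j t ![(((i, k), σ), 0), (((i, k'), σ), 1), ((((omega0 M).rev, Qm - y), 1), 0), ((((omega0 M).rev, Qm - x), 1), 1)] -
          V j t ![(((omega0 M, k), σ), 1), (((omega0 M, k'), σ), 0), (((omega0 M, y), 0), 0), (((omega0 M, x), 0), 1)] *
            V j t ![(((omega0 M, k), σ), 0), (((omega0 M, k'), σ), 1), ((((omega0 M).rev, Qm - y), 1), 0), ((((omega0 M).rev, Qm - x), 1), 1)]‖ ≤ ε)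
    (hY0B : ∀ t ∈ Icc (0 : ℝ) 1, ∀ k : TorusSite 2 L, ‖V j t ![(((omega0 M, k), 0), 1), ((((omega0 M).rev, k + (Qm - x - y)), 1), 0), (((omega0 M, y), 0), 0), ((((omega0 M).rev, Qm - x), 1), 1)] *
        V j t ![(((omega0 M, k), 0), 0), ((((omega0 M).rev, k + (Qm - x - y)), 1), 1), ((((omega0 M).rev, Qm - y), 1), 0), (((omega0 M, x), 0), 1)]‖ ≤ A₀)
    (hY1B : ∀ t ∈ Icc (0 : ℝ) 1, ∀ k k' : TorusSite 2 L,
      ‖V j t ![(((omega0 M, k), 0), 1), ((((omega0 M).rev, k + (Qm - x - y)), 1), 0), (((omega0 M, y), 0), 0), ((((omega0 M).rev, Qm - x), 1), 1)] *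
            V j t ![(((omega0 M, k), 0), 0), ((((omega0 M).rev, k + (Qm - x - y)), 1), 1), ((((omega0 M).rev, Qm - y), 1), 0), (((omega0 M, x), 0), 1)] -
          V j t ![(((omega0 M, k'), 0), 1), ((((omega0 M).rev, k' + (Qm - x - y)), 1), 0), (((omega0 M, y), 0), 0), ((((omega0 M).rev, Qm - x), 1), 1)] *
            V j t ![(((omega0 M, k'), 0), 0), ((((omega0 M).rev, k' + (Qm - x - y)), 1), 1), ((((omega0 M).rev, Qm - y), 1), 0), (((omega0 M, x), 0), 1)]‖ ≤
        LA * klTorusNorm L (k - k'))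
    (hY0A : ∀ t ∈ Icc (0 : ℝ) 1, ∀ k : TorusSite 2 L, ‖V j t ![(((omega0 M, k + -(Qm - x - y)), 0), 1), ((((omega0 M).rev, k), 1), 0), (((omega0 M, y), 0), 0), ((((omega0 M).rev, Qm - x), 1), 1)] *
        V j t ![(((omega0 M, k + -(Qm - x - y)), 0), 0), ((((omega0 M).rev, k), 1), 1), ((((omega0 M).rev, Qm - y), 1), 0), (((omega0 M, x), 0), 1)]‖ ≤ A₀)
    (hY1A : ∀ t ∈ Icc (0 : ℝ) 1, ∀ k k' : TorusSite 2 L,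
      ‖V j t ![(((omega0 M, k + -(Qm - x - y)), 0), 1), ((((omega0 M).rev, k), 1), 0), (((omega0 M, y), 0), 0), ((((omega0 M).rev, Qm - x), 1), 1)] *
            V j t ![(((omega0 M, k + -(Qm - x - y)), 0), 0), ((((omega0 M).rev, k), 1), 1), ((((omega0 M).rev, Qm - y), 1), 0), (((omega0 M, x), 0), 1)] -
          V j t ![(((omega0 M, k' + -(Qm - x - y)), 0), 1), ((((omega0 M).rev, k'), 1), 0), (((omega0 M, y), 0), 0), ((((omega0 M).rev, Qm - x), 1), 1)] *
            V j t ![(((omega0 M, k' + -(Qm - x - y)), 0), 0), ((((omega0 M).rev, k'), 1), 1), ((((omega0 M).rev, Qm - y), 1), 0), (((omega0 M, x), 0), 1)]‖ ≤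
        LA * klTorusNorm L (k - k'))
    (hflatX : ∀ t ∈ Icc (0 : ℝ) 1, ∀ (i i' : MatsubaraIdx M) (k k' : TorusSite 2 L), matsubaraInt M i' + 1 = matsubaraInt M i →
      matsubaraFreq β M i ^ 2 ≤ (5 * klScale klE0 (n + 1)) ^ 2 →
      ‖V j t ![(((i, k), 0), 1), (((i', k'), 1), 0), (((omega0 M, y), 0), 0), ((((omega0 M).rev, Qm - x), 1), 1)] *
            V j t ![(((i, k), 0), 0), (((i', k'), 1), 1), ((((omega0 M).rev, Qm - y), 1), 0), (((omega0 M, x), 0), 1)] -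
          V j t ![(((omega0 M, k), 0), 1), ((((omega0 M).rev, k'), 1), 0), (((omega0 M, y), 0), 0), ((((omega0 M).rev, Qm - x), 1), 1)] *
            V j t ![(((omega0 M, k), 0), 0), ((((omega0 M).rev, k'), 1), 1), ((((omega0 M).rev, Qm - y), 1), 0), (((omega0 M, x), 0), 1)]‖ ≤ ε)
    {A₀S LAS εS : ℝ} (hA0S : 0 ≤ A₀S) (hLAS : 0 ≤ LAS) (hεS : 0 ≤ εS)
    (hY0S : ∀ t ∈ Icc (0 : ℝ) 1, ∀ k : TorusSite 2 L, ‖∑ σ : Fin 2, V6 j t ![(((omega0 M, k), σ), 0), (((omega0 M, k), σ), 1), (((omega0 M, y), 0), 0), ((((omega0 M).rev, Qm - y), 1), 0),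
        ((((omega0 M).rev, Qm - x), 1), 1), (((omega0 M, x), 0), 1)] * Sg j t (omega0 M, k) σ‖ ≤ A₀S)
    (hY1S : ∀ t ∈ Icc (0 : ℝ) 1, ∀ k k' : TorusSite 2 L, ‖(∑ σ : Fin 2, V6 j t ![(((omega0 M, k), σ), 0), (((omega0 M, k), σ), 1), (((omega0 M, y), 0), 0), ((((omega0 M).rev, Qm - y), 1), 0),
          ((((omega0 M).rev, Qm - x), 1), 1), (((omega0 M, x), 0), 1)] * Sg j t (omega0 M, k) σ) -
        ∑ σ : Fin 2, V6 j t ![(((omega0 M, k'), σ), 0), (((omega0 M, k'), σ), 1), (((omega0 M, y), 0), 0), ((((omega0 M).rev, Qm - y), 1), 0),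
          ((((omega0 M).rev, Qm - x), 1), 1), (((omega0 M, x), 0), 1)] * Sg j t (omega0 M, k') σ‖ ≤ LAS * klTorusNorm L (k - k'))
    (hflatS : ∀ t ∈ Icc (0 : ℝ) 1, ∀ (i : MatsubaraIdx M) (σ : Fin 2) (k : TorusSite 2 L), matsubaraFreq β M i ^ 2 ≤ (4 * klScale klE0 (n + 1)) ^ 2 →
      ‖V6 j t ![(((i, k), σ), 0), (((i, k), σ), 1), (((omega0 M, y), 0), 0), ((((omega0 M).rev, Qm - y), 1), 0), ((((omega0 M).rev, Qm - x), 1), 1),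
              (((omega0 M, x), 0), 1)] * Sg j t (i, k) σ -
          V6 j t ![(((omega0 M, k), σ), 0), (((omega0 M, k), σ), 1), (((omega0 M, y), 0), 0), ((((omega0 M).rev, Qm - y), 1), 0), ((((omega0 M).rev, Qm - x), 1), 1),
              (((omega0 M, x), 0), 1)] * Sg j t (omega0 M, k) σ‖ ≤ εS)
    (hTHS : (393216 / Real.pi * (64 * (klScale klE0 (n + 1) / klScale klE0 j) ^ 2 + (2 * (448 / 3 * Real.exp 2) + 8) + 64) * (2 * A₀S * (Real.pi * Real.sqrt 2 / (B.Dtmin - 4 * Af)))) ≤ 2 ^ 77 * (P.Klam * U) ^ 2)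
    (hZS : (524288 / Real.pi * (64 * (klScale klE0 (n + 1) / klScale klE0 j) ^ 2 + (2 * (448 / 3 * Real.exp 2) + 8) + 64) * (Real.pi * Real.sqrt 2 / (B.Dtmin - 4 * Af) * (2 * LA + 2 * A₀ * (2 / (1 / 10))) / (B.Dtmin - 4 * Af) + 2 * A₀ * (1 / (B.Dtmin - 4 * Af) ^ 2 + Real.pi * Real.sqrt 2 * (2 + 4 * Af) / (B.Dtmin - 4 * Af) ^ 3))) ≤ 2 ^ 52 * (P.Klam * U) ^ 2)
    (hTH : (393216 / Real.pi * (64 * (klScale klE0 (n + 1) / klScale klE0 j) ^ 2 + (2 * (448 / 3 * Real.exp 2) + 8) + 64) * (2 * A₀ * (Real.pi * Real.sqrt 2 / (B.Dtmin - 4 * Af)))) ≤ 2 ^ 76 * (P.Klam * U) ^ 2)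
    (hTHR : (393216 / Real.pi * (64 * (klScale klE0 (n + 1) / klScale klE0 j) ^ 2 + (2 * (448 / 3 * Real.exp 2) + 8) + 64) * (2 * A₀ * (Real.pi * Real.sqrt 2 / (B.Dtmin - 4 * Af)))) + 2 * (256 / Real.pi * 8 * (2 * A₀ * (Real.pi * Real.sqrt 2 / (B.Dtmin - 4 * Af))) * (65 * (8 * (16 : ℝ) ^ (j - (n + 1))) + 17408 / 3 * 1)) ≤ 2 ^ 76 * (P.Klam * U) ^ 2)
    (hTR : (256 / Real.pi * 8 * (2 * A₀ * (Real.pi * Real.sqrt 2 / (B.Dtmin - 4 * Af))) * (65 * (8 * (16 : ℝ) ^ (j - (n + 1))) + 17408 / 3 * 1)) * (4 + 8 / 3 * R.Gfr 1 * U ^ 2) ≤ 2 ^ 52 * (P.Klam * U) ^ 2) :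
    ‖A j Qm 1 x y - A j Qm 0 x y‖ ≤
      (klScale klE0 n - klScale klE0 (n + 1)) * (2⁻¹ * RH) + RL +
        gainBar klEngGeo11 P U (n + 1) (klTorusNorm L Qm) (klTorusNorm L (x - y)) (klTorusNorm L (x + y - Qm)) +
        thermalBar klEngGeo11 P U β (n + 1) + 4 * ((96 * (512 * LA / klScale klE0 (n + 1) + 32 * A₀ * (4 + 8 / 3 * R.Gfr 1 * U ^ 2) * ((9 * (2 * (448 / 3 * Real.exp 2) + 8) + 4 * 8) + (65 * (8 * (16 : ℝ) ^ (j - (n + 1))) + 17408 / 3 * 1)) / klScale klE0 (n + 1) ^ 2)) / L) + 2 * (ε * (2048 * 15367)) +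
        ((524288 / Real.pi * (64 * (klScale klE0 (n + 1) / klScale klE0 j) ^ 2 + (2 * (448 / 3 * Real.exp 2) + 8) + 64) * (Real.pi * Real.sqrt 2 / (B.Dtmin - 4 * Af) * (2 * LAS + 2 * A₀S * (2 / (1 / 10))) / (B.Dtmin - 4 * Af) + 2 * A₀S * (1 / (B.Dtmin - 4 * Af) ^ 2 + Real.pi * Real.sqrt 2 * (2 + 4 * Af) / (B.Dtmin - 4 * Af) ^ 3))) * klScale klE0 (n + 1) + 2 * ((96 * (512 * LAS / klScale klE0 (n + 1) + 32 * A₀S * (4 + 8 / 3 * R.Gfr 1 * U ^ 2) * ((9 * (2 * (448 / 3 * Real.exp 2) + 8) + 4 * 8) + (65 * (8 * (16 : ℝ) ^ (j - (n + 1))) + 17408 / 3 * 1)) / klScale klE0 (n + 1) ^ 2)) / L) + 2 * (εS * (2048 * 15367))) := by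
  have hGfr' : ∀ j, 0 ≤ R.Gfr j := hR.wf.2.2
  have hn' : n + 1 ≤ nScales β + 1 := by omega
  have hsucc : klScale klE0 (n + 1) = klScale klE0 n / 4 := klth_klScale_succ n
  have hΛ1 : 0 < klScale klE0 (n + 1) := klth_klScale_pos (n + 1)
  have hβ0 : 0 < β := pos_of_klBetaMin_le hβ
  have hL0 : (0 : ℝ) < L := by exact_mod_cast Nat.pos_of_ne_zero (NeZero.ne L)
  have ha : 0 < (klScale klE0 n - klScale klE0 (n + 1)) := by rw [hsucc]; linarith
  have hc : 0 < ((β * (L : ℝ) ^ 2) ^ 3)⁻¹ := by positivity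
  have hac : 0 < (klScale klE0 n - klScale klE0 (n + 1)) * ((β * (L : ℝ) ^ 2) ^ 3)⁻¹ := mul_pos ha hc
  -- the signed born line at every `t`
  have hborn : ∀ t ∈ Icc (0 : ℝ) 1, (klScale klE0 n - klScale klE0 (n + 1)) * ((β * (L : ℝ) ^ 2) ^ 3)⁻¹ *
      ‖(∑ p : FreqMomentum L M, ∑ σ : Fin 2,
            (((((Wd t p) : ℝ) : ℂ) * (((β * (L : ℝ) ^ 2 : ℝ) : ℂ) * propCT L M β μ K p)) * ((((Φ j t p) : ℝ) : ℂ) * (((β * (L : ℝ) ^ 2 : ℝ) : ℂ) * propCT L M β μ K p))) *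
              (V6 j t ![((p, σ), 0), ((p, σ), 1), (((omega0 M, y), 0), 0), ((((omega0 M).rev, Qm - y), 1), 0), ((((omega0 M).rev, Qm - x), 1), 1),
                (((omega0 M, x), 0), 1)] *
                Sg j t p σ))‖ ≤
      ((524288 / Real.pi * (64 * (klScale klE0 (n + 1) / klScale klE0 j) ^ 2 + (2 * (448 / 3 * Real.exp 2) + 8) + 64) * (Real.pi * Real.sqrt 2 / (B.Dtmin - 4 * Af) * (2 * LAS + 2 * A₀S * (2 / (1 / 10))) / (B.Dtmin - 4 * Af) + 2 * A₀S * (1 / (B.Dtmin - 4 * Af) ^ 2 + Real.pi * Real.sqrt 2 * (2 + 4 * Af) / (B.Dtmin - 4 * Af) ^ 3))) * klScale klE0 (n + 1) / 2 + thermalBar klEngGeo11 P U β (n + 1) / 4 + (96 * (512 * LAS / klScale klE0 (n + 1) + 32 * A₀S * (4 + 8 / 3 * R.Gfr 1 * U ^ 2) * ((9 * (2 * (448 / 3 * Real.exp 2) + 8) + 4 * 8) + (65 * (8 * (16 : ℝ) ^ (j - (n + 1))) + 17408 / 3 * 1)) / klScale klE0 (n + 1) ^ 2)) / L + εS * (2048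 * 15367)) := fun t ht =>
    born_member_row_signed_le_quarter B hGfr' hK hAb hA hA20 hμ n ht hβ hn' hM Φ hΦ Wd hWd V6 Sg hj Qm x y hlo hhi hA0S hLAS hεS
      (hY0S t ht) (hY1S t ht) (hflatS t ht) hβL P hTHS
  -- the capstone with `RS := B_S/(a·c)`
  have hmain := outClass_sameFrame_le_slots L M β U μ K B hR hU hUu hμC hK hβ hβL hn hGL hGU hAb hA hA20 hμ hlo hhi hM A A' b' hAdef hA'def hb'def
    V hV V6 hV6 Sg hSg Hd hHd Φ hΦ Wd hWd Br hBr j hj hQ hZ hm0 hm hAm x y hM40 hM4 hM4K hM4KG hH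
    (RS := ((524288 / Real.pi * (64 * (klScale klE0 (n + 1) / klScale klE0 j) ^ 2 + (2 * (448 / 3 * Real.exp 2) + 8) + 64) * (Real.pi * Real.sqrt 2 / (B.Dtmin - 4 * Af) * (2 * LAS + 2 * A₀S * (2 / (1 / 10))) / (B.Dtmin - 4 * Af) + 2 * A₀S * (1 / (B.Dtmin - 4 * Af) ^ 2 + Real.pi * Real.sqrt 2 * (2 + 4 * Af) / (B.Dtmin - 4 * Af) ^ 3))) * klScale klE0 (n + 1) / 2 + thermalBar klEngGeo11 P U β (n + 1) / 4 + (96 * (512 * LAS / klScale klE0 (n + 1) + 32 * A₀S * (4 + 8 / 3 * R.Gfr 1 * U ^ 2) * ((9 * (2 * (448 / 3 * Real.exp 2) + 8) + 4 * 8) + (65 * (8 * (16 : ℝ) ^ (j - (n + 1))) + 17408 / 3 * 1)) / klScale klE0 (n + 1) ^ 2)) / L + εS * (2048 * 15367)) / ((klScale klE0 n - klScale klE0 (n + 1)) * ((β * (L : ℝ) ^ 2) ^ 3)⁻¹))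
    (fun t ht => (le_div_iff₀' hac).mpr (hborn t ht)) hL hA0 hLA hε hY0p hY1p hY0m hY1m hflat hY0B hY1B hY0A hY1A hflatX hZS hTH hTHR hTR
  have e : (klScale klE0 n - klScale klE0 (n + 1)) * (2⁻¹ * RH + ((β * (L : ℝ) ^ 2) ^ 3)⁻¹ * (2 * (((524288 / Real.pi * (64 * (klScale klE0 (n + 1) / klScale klE0 j) ^ 2 + (2 * (448 / 3 * Real.exp 2) + 8) + 64) * (Real.pi * Real.sqrt 2 / (B.Dtmin - 4 * Af) * (2 * LAS + 2 * A₀S * (2 / (1 / 10))) / (B.Dtmin - 4 * Af) + 2 * A₀S * (1 / (B.Dtmin - 4 * Af) ^ 2 + Real.pi * Real.sqrt 2 * (2 + 4 * Af) / (B.Dtmin - 4 * Af) ^ 3))) * klScale klE0 (n + 1) / 2 + thermalBar klEngGeo11 P U β (n + 1) / 4 + (96 * (512 * LAS / klScale klE0 (n + 1) + 32 * A₀S * (4 + 8 / 3 * R.Gfr 1 * U ^ 2) * ((9 * (2 * (448 / 3 * Real.exp 2) + 8) + 4 * 8) + (65 * (8 * (16 : ℝ) ^ (j - (n + 1))) +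 17408 / 3 * 1)) / klScale klE0 (n + 1) ^ 2)) / L + εS * (2048 * 15367)) / ((klScale klE0 n - klScale klE0 (n + 1)) * ((β * (L : ℝ) ^ 2) ^ 3)⁻¹)))) =
      (klScale klE0 n - klScale klE0 (n + 1)) * (2⁻¹ * RH) + 2 * ((524288 / Real.pi * (64 * (klScale klE0 (n + 1) / klScale klE0 j) ^ 2 + (2 * (448 / 3 * Real.exp 2) + 8) + 64) * (Real.pi * Real.sqrt 2 / (B.Dtmin - 4 * Af) * (2 * LAS + 2 * A₀S * (2 / (1 / 10))) / (B.Dtmin - 4 * Af) + 2 * A₀S * (1 / (B.Dtmin - 4 * Af) ^ 2 + Real.pi * Real.sqrt 2 * (2 + 4 * Af) / (B.Dtmin - 4 * Af) ^ 3))) * klScale klE0 (n + 1) / 2 + thermalBar klEngGeo11 P U β (n + 1) / 4 + (96 * (512 * LAS / klScale klE0 (n + 1) + 32 * A₀S * (4 + 8 / 3 * R.Gfr 1 * U ^ 2) * ((9 * (2 * (448 / 3 * Real.exp 2) + 8) + 4 * 8) + (65 * (8 * (16 : ℝ) ^ (j - (n + 1))) + 17408 / 3 * 1)) / klScale klE0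 (n + 1) ^ 2)) / L + εS * (2048 * 15367)) := by
    field_simp
  rw [e] at hmain
  linarith only [hmain]

end Model

end Summit.HubbardSuperconductivity.HubbardSuperconductivity.Theorems.KLRegimeSplit

end
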